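import Mathlib.Analysis.SpecialFunctions.Log.Basic
import Mathlib.Analysis.SpecialFunctions.Pow.Real
import HarnessLib

/-!
# Route `UnitScaleTilt`, crux K1 «MinimiserStabilityRegPr» (stmt-QuantumFields-19200), EX row `hGF[Lift]` (curved member) — **LOD LINE, THE CLOSING KNIT, (D3b): THE MEMBER-INPUT BUDGET
# LETTERS** — px10 g11's CLOSING-KNIT PLAN v2 (2026-08-30 05:17:41Z) splits the GRAND WINDOW (D3) into (D3a) the coefficient window (w2 g12 ✓`Prop7LODMemberWindow.exists_window_letters`,
# p759734), (D3b) the member-input budget letters (this file) and (D3c) the `min`-glue.  (D3b) is PURE REAL ARITHMETIC with NO member letter: given routeR-w3 g13's K-free letter-bound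
# SHAPES for px5's three per-cube row constants — `cG ≤ PG₁·ν + PG₂·ε₀·(Rb+9+W₀)`, `cQ ≤ PQ·ε₀·(Rb+9+W₀) + TQ·e^{−μa((Bt−1)∕ν)}`, `εN ≤ PN₁·ν + PN₂·ε₀·(Rb+9+W₀) + TN·e^{−μa((Bt−1)∕ν)}`
# (coefficients ≥ 0, `W₀ = L²`-class) — and the three quarter-budget TARGETS `qG qQ qN > 0` of ✓`Prop7LocalProjectorRowCubeWindow.deltaPmax_le_of_budget` (routeR-w4 g27, p761437), it
# CHOOSES `ν ∈ (0,1]`, `Bt ≥ 1`, `Rb : ℕ` (with the radius row `X₀ + r + (Bt+1)∕ν ≤ Rb`, any offset `X₀` and near radius `r`) and `ε₁ > 0` such that for EVERY `ε₀ ∈ (0, ε₁]` the three bounds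
# sit inside the targets and the radius–regularity coupling `24·ε₀·(Rb+9) ≤ 1` holds — ∃-packaged (px10's (D4) `choose`s), every witness a closed term of the inputs.

Cell `ym3-torus` (HUMAN RULING D-0037, YM ladder rung R3 — NOT d = 4, NOT infinite volume, NOT a mass gap, NOT Clay).  Width seat `ym-routeR-w4` gen 27 («MINE D3b» 05:18:09Z; w2 g12 05:18:51Z
«SPLIT ACCEPTED»; routeR-w3 g13 holds the letter bounds themselves).  THEOREMS ONLY (0 `def`, 0 `sorry`); `--supports stmt-QuantumFields-19200 --as helper`, count-neutral.  HONEST LABEL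
(★★OWNER RULING №33 (6)): curved γ-row supplier line, closing-knit arithmetic; nothing of the letter bounds (routeR-w3), the coefficient window (w2), `hlarge`∕`hT_exists` (px10), `hGF`∕S45, EX ∕
19200 is proved here.  HONEST SIZE: with `μa ≈ 1.5·10⁻³`, `qG ~ 10⁻³⁷`-class targets and `TQ, TN ~ 10²`, the tail forces `(Bt−1)∕ν ≈ μa⁻¹·log(10³⁹) ≈ 6·10⁴` and `ε₁ ~ 10⁻⁴⁰∕Rb` — numbers for
the COVER road only (chair WORD №1), printed, not hidden.

WHAT IS PROVED (ns `Summit.QuantumFields.YangMills.Theorems.Prop7LODBudgetLetters`).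
* §1 `mul_div_succ_le` (`c·(q∕(kc+1)) ≤ q∕k`), `mul_mul_le_of_le` (monotone use of a budget).
* §2 ★★★ `exists_budget_letters` — the statement above; ORDER OF CHOICE `ν := min 1 (min (qG∕(2PG₁+1)) (qN∕(3PN₁+1)))`, `Bt := 1 + (ν∕μa)·log(2TQ∕qQ + 3TN∕qN + 1)` (so the tail equals
  `(2TQ∕qQ + 3TN∕qN + 1)⁻¹`), `Rb := ⌈X₀ + r + (Bt+1)∕ν⌉₊`, `ε₁ := min` of `qG∕(2PG₂R+1)`, `qQ∕(2PQ·R+1)`, `qN∕(3PN₂R+1)`, `1∕(24(Rb+9)+1)` (`R = Rb+9+W₀`).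
* §3 `mu_pos`, `ten_mu_le_one` — the closed window slope `μ(a) := 1∕(10·√(max 2 (16∕a))·√(27 + (2025∕8)a))` of ✓`hKP_pin`∕✓`hloc_pin` is positive with `10·μ(a) ≤ 1` (so `3μ(a) ≤ 1` for
  ✓`window_delta`∕✓`window_win` at `μa := μ(am)` — px10's `hδw`∕`hwin`).

References: T. Bałaban, CMP **99** (1985) 389–434 [Balaban1985BackgroundPropagators] ((3.49) p.399, Thm 3.11 p.416).
-/

set_option autoImplicit false

noncomputable section

namespace Summit.QuantumFields.YangMills.Theorems.Prop7LODBudgetLetters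

/-- `c·(q∕(k·c + 1)) ≤ q∕k` for `c ≥ 0`, `q ≥ 0`, `k > 0` (the «half∕third of a budget» step). [cite: Balaban1985BackgroundPropagators, (3.49) p.399] -/
theorem mul_div_succ_le {c q k : ℝ} (hc : 0 ≤ c) (hq : 0 ≤ q) (hk : 0 < k) : c * (q / (k * c + 1)) ≤ q / k := by
  rw [mul_div_assoc', div_le_div_iff₀ (by positivity) hk]
  nlinarith

/-- Monotone use of a budget: `P·ε₀·R ≤ P·ε₁·R` for `0 ≤ P`, `0 ≤ R`, `ε₀ ≤ ε₁`. [cite: Balaban1985BackgroundPropagators, (3.49) p.399] -/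
theorem mul_mul_le_of_le {P R ε₀ ε₁ : ℝ} (hP : 0 ≤ P) (hR : 0 ≤ R) (h : ε₀ ≤ ε₁) : P * ε₀ * R ≤ P * ε₁ * R := by
  have := mul_le_mul_of_nonneg_left h hP
  exact mul_le_mul_of_nonneg_right this hR

/-- ★★★ **THE MEMBER-INPUT BUDGET LETTERS (D3b of the closing knit)** — pure real arithmetic, no member letters.  Given non-negative coefficients `PG₁ PG₂ PQ TQ PN₁ PN₂ TN` (routeR-w3 g13's
K-free letter bounds `cG ≤ PG₁·ν + PG₂·ε₀·(Rb+9+W₀)`, `cQ ≤ PQ·ε₀·(Rb+9+W₀) + TQ·e^{−μa(Bt−1)∕ν}`, `εN ≤ PN₁·ν + PN₂·ε₀·(Rb+9+W₀) + TN·e^{−μa(Bt−1)∕ν}`), a slope `μa > 0`, positive targets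
`qG qQ qN` (✓`deltaPmax_le_of_budget`'s quarter-budget right-hand sides `t∕(8√s·A)`, `t∕(8A)`, `t∕(4B)`), any radius offset `X₀`, near radius `r` and width term `W₀ ≥ 0` (`9 + L²`-class), there are
`ν ∈ (0,1]`, `Bt ≥ 1`, a block radius `Rb : ℕ` with `X₀ + r + (Bt+1)∕ν ≤ Rb`, and `ε₁ > 0` such that for every `ε₀ ∈ (0, ε₁]` the three bounds sit inside the targets and `24ε₀(Rb+9) ≤ 1`.
ORDER OF CHOICE: `ν := min 1 (min (qG∕(2PG₁+1)) (qN∕(3PN₁+1)))`, `Bt := 1 + (ν∕μa)·log(2TQ∕qQ + 3TN∕qN + 1)` (so `e^{−μa(Bt−1)∕ν} = (2TQ∕qQ + 3TN∕qN + 1)⁻¹`), `Rb := ⌈X₀ + r + (Bt+1)∕ν⌉₊`,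
`ε₁ := min (min (qG∕(2PG₂R+1)) (qQ∕(2PQ·R+1))) (min (qN∕(3PN₂R+1)) (1∕(24(Rb+9)+1)))`, `R := Rb + 9 + W₀`. [cite: Balaban1985BackgroundPropagators, (3.49) p.399, Thm 3.11 p.416] -/
theorem exists_budget_letters {PG₁ PG₂ PQ TQ PN₁ PN₂ TN μa qG qQ qN W₀ : ℝ} (X₀ r : ℝ)
    (hPG₁ : 0 ≤ PG₁) (hPG₂ : 0 ≤ PG₂) (hPQ : 0 ≤ PQ) (hTQ : 0 ≤ TQ) (hPN₁ : 0 ≤ PN₁) (hPN₂ : 0 ≤ PN₂) (hTN : 0 ≤ TN)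
    (hμa : 0 < μa) (hqG : 0 < qG) (hqQ : 0 < qQ) (hqN : 0 < qN) (hW₀ : 0 ≤ W₀) :
    ∃ (ν Bt ε₁ : ℝ) (Rb : ℕ), 0 < ν ∧ ν ≤ 1 ∧ 1 ≤ Bt ∧ X₀ + r + (Bt + 1) / ν ≤ (Rb : ℝ) ∧ 0 < ε₁ ∧
      ∀ ε₀ : ℝ, 0 < ε₀ → ε₀ ≤ ε₁ →
        PG₁ * ν + PG₂ * ε₀ * ((Rb : ℝ) + 9 + W₀) ≤ qG ∧
        PQ * ε₀ * ((Rb : ℝ) + 9 + W₀) + TQ * Real.exp (-(μa * ((Bt - 1) / ν))) ≤ qQ ∧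
        PN₁ * ν + PN₂ * ε₀ * ((Rb : ℝ) + 9 + W₀) + TN * Real.exp (-(μa * ((Bt - 1) / ν))) ≤ qN ∧
        24 * ε₀ * ((Rb : ℝ) + 9) ≤ 1 := by
  -- ν
  set ν : ℝ := min 1 (min (qG / (2 * PG₁ + 1)) (qN / (3 * PN₁ + 1))) with hνdef
  have hν0 : 0 < ν := lt_min one_pos (lt_min (by positivity) (by positivity))
  have hν1 : ν ≤ 1 := min_le_left _ _
  have hνG : PG₁ * ν ≤ qG / 2 := by
    calc PG₁ * ν ≤ PG₁ * (qG / (2 * PG₁ + 1)) := mul_le_mul_of_nonneg_left ((min_le_right _ _).trans (min_le_left _ _)) hPG₁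
      _ ≤ qG / 2 := mul_div_succ_le hPG₁ hqG.le two_pos
  have hνN : PN₁ * ν ≤ qN / 3 := by
    calc PN₁ * ν ≤ PN₁ * (qN / (3 * PN₁ + 1)) := mul_le_mul_of_nonneg_left ((min_le_right _ _).trans (min_le_right _ _)) hPN₁
      _ ≤ qN / 3 := mul_div_succ_le hPN₁ hqN.le (by norm_num)
  -- Bt and the tail
  set Z : ℝ := 2 * TQ / qQ + 3 * TN / qN + 1 with hZdef
  have hZ1 : 1 ≤ Z := by
    have h0 : (0 : ℝ) ≤ 2 * TQ / qQ + 3 * TN / qN := by positivity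
    rw [hZdef]; linarith
  have hZ0 : 0 < Z := by linarith
  set Bt : ℝ := 1 + ν / μa * Real.log Z with hBtdef
  have hBt1 : 1 ≤ Bt := by
    have hl := Real.log_nonneg hZ1
    have hd := (div_pos hν0 hμa).le
    rw [hBtdef]; nlinarith
  have htail : Real.exp (-(μa * ((Bt - 1) / ν))) = Z⁻¹ := by
    have e : μa * ((Bt - 1) / ν) = Real.log Z := by rw [hBtdef]; field_simp; ring
    rw [e, Real.exp_neg, Real.exp_log hZ0]
  have hTQ' : TQ * Real.exp (-(μa * ((Bt - 1) / ν))) ≤ qQ / 2 := by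
    rw [htail, ← div_eq_mul_inv, div_le_div_iff₀ hZ0 two_pos, hZdef]
    have h1 : TQ * 2 ≤ qQ * (2 * TQ / qQ) := by rw [mul_div_assoc', mul_comm qQ, mul_div_assoc, div_self hqQ.ne', mul_one]; linarith
    have h2 : 0 ≤ qQ * (3 * TN / qN) := by positivity
    nlinarith
  have hTN' : TN * Real.exp (-(μa * ((Bt - 1) / ν))) ≤ qN / 3 := by
    rw [htail, ← div_eq_mul_inv, div_le_div_iff₀ hZ0 (by norm_num : (0:ℝ) < 3), hZdef]
    have h1 : TN * 3 ≤ qN * (3 * TN / qN) := by rw [mul_div_assoc', mul_comm qN, mul_div_assoc, div_self hqN.ne', mul_one]; linarith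
    have h2 : 0 ≤ qN * (2 * TQ / qQ) := by positivity
    nlinarith
  -- Rb
  set Rb : ℕ := ⌈X₀ + r + (Bt + 1) / ν⌉₊ with hRbdef
  have hRb : X₀ + r + (Bt + 1) / ν ≤ (Rb : ℝ) := Nat.le_ceil _
  have hR0 : 0 ≤ (Rb : ℝ) + 9 + W₀ := by positivity
  have hR9 : 0 < (Rb : ℝ) + 9 := by positivity
  set R : ℝ := (Rb : ℝ) + 9 + W₀ with hRdef
  -- ε₁
  set ε₁ : ℝ := min (min (qG / (2 * (PG₂ * R) + 1)) (qQ / (2 * (PQ * R) + 1))) (min (qN / (3 * (PN₂ * R) + 1)) (1 / (24 * ((Rb : ℝ) + 9) + 1)))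
    with hε₁def
  have hε₁0 : 0 < ε₁ := lt_min (lt_min (by positivity) (by positivity)) (lt_min (by positivity) (by positivity))
  refine ⟨ν, Bt, ε₁, Rb, hν0, hν1, hBt1, hRb, hε₁0, fun ε₀ hε₀ hε₀1 => ⟨?_, ?_, ?_, ?_⟩⟩
  · -- cG budget
    have hG2 : PG₂ * ε₀ * R ≤ qG / 2 := by
      have hb : ε₀ ≤ qG / (2 * (PG₂ * R) + 1) := hε₀1.trans ((min_le_left _ _).trans (min_le_left _ _))
      calc PG₂ * ε₀ * R ≤ PG₂ * (qG / (2 * (PG₂ * R) + 1)) * R := mul_mul_le_of_le hPG₂ hR0 hb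
        _ = (PG₂ * R) * (qG / (2 * (PG₂ * R) + 1)) := by ring
        _ ≤ qG / 2 := mul_div_succ_le (by positivity) hqG.le two_pos
    linarith [hνG, hG2]
  · -- cQ budget
    have hQ2 : PQ * ε₀ * R ≤ qQ / 2 := by
      have hb : ε₀ ≤ qQ / (2 * (PQ * R) + 1) := hε₀1.trans ((min_le_left _ _).trans (min_le_right _ _))
      calc PQ * ε₀ * R ≤ PQ * (qQ / (2 * (PQ * R) + 1)) * R := mul_mul_le_of_le hPQ hR0 hb
        _ = (PQ * R) * (qQ / (2 * (PQ * R) + 1)) := by ring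
        _ ≤ qQ / 2 := mul_div_succ_le (by positivity) hqQ.le two_pos
    linarith [hQ2, hTQ']
  · -- εN budget
    have hN2 : PN₂ * ε₀ * R ≤ qN / 3 := by
      have hb : ε₀ ≤ qN / (3 * (PN₂ * R) + 1) := hε₀1.trans ((min_le_right _ _).trans (min_le_left _ _))
      calc PN₂ * ε₀ * R ≤ PN₂ * (qN / (3 * (PN₂ * R) + 1)) * R := mul_mul_le_of_le hPN₂ hR0 hb
        _ = (PN₂ * R) * (qN / (3 * (PN₂ * R) + 1)) := by ring
        _ ≤ qN / 3 := mul_div_succ_le (by positivity) hqN.le (by norm_num)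
    linarith [hνN, hN2, hTN']
  · -- the radius–regularity coupling `24 ε₀ (Rb + 9) ≤ 1`
    have hb : ε₀ ≤ 1 / (24 * ((Rb : ℝ) + 9) + 1) := hε₀1.trans ((min_le_right _ _).trans (min_le_right _ _))
    calc 24 * ε₀ * ((Rb : ℝ) + 9) ≤ 24 * (1 / (24 * ((Rb : ℝ) + 9) + 1)) * ((Rb : ℝ) + 9) := mul_mul_le_of_le (by norm_num) hR9.le hb
      _ = (24 * ((Rb : ℝ) + 9)) * (1 / (1 * (24 * ((Rb : ℝ) + 9)) + 1)) := by ring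
      _ ≤ 1 / 1 := mul_div_succ_le (by positivity) zero_le_one one_pos
      _ = 1 := by norm_num

/-! ## §3 The closed window slope `μ(a)` of ✓`hKP_pin`∕✓`hloc_pin`: positive, `10μ ≤ 1` -/

/-- `0 < μ(a) = 1∕(10·√(max 2 (16∕a))·√(27 + (2025∕8)a))` for `0 < a`. [cite: Balaban1985BackgroundPropagators, (3.46) p.398] -/
theorem mu_pos {a : ℝ} (ha : 0 < a) : 0 < 1 / (10 * Real.sqrt (max 2 (16 / a)) * Real.sqrt (27 + 2025 / 8 * a)) := by
  have hM : (2 : ℝ) ≤ max 2 (16 / a) := le_max_left _ _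
  positivity

/-- `10·μ(a) ≤ 1` (hence `3μ(a) ≤ 1`, the antecedent of ✓`Prop7LODSlotK2WindowLetters.window_delta` at slope `μa := μ(a)`). [cite: Balaban1985BackgroundPropagators, (3.46) p.398] -/
theorem ten_mu_le_one {a : ℝ} (ha : 0 < a) : 10 * (1 / (10 * Real.sqrt (max 2 (16 / a)) * Real.sqrt (27 + 2025 / 8 * a))) ≤ 1 := by
  have hM : (2 : ℝ) ≤ max 2 (16 / a) := le_max_left _ _
  have hsM1 : 1 ≤ Real.sqrt (max 2 (16 / a)) := Real.one_le_sqrt.2 (by linarith)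
  have hsc1 : 1 ≤ Real.sqrt (27 + 2025 / 8 * a) := Real.one_le_sqrt.2 (by linarith [ha.le])
  have h1 : (1 : ℝ) ≤ Real.sqrt (max 2 (16 / a)) * Real.sqrt (27 + 2025 / 8 * a) := one_le_mul_of_one_le_of_one_le hsM1 hsc1
  rw [show 10 * (1 / (10 * Real.sqrt (max 2 (16 / a)) * Real.sqrt (27 + 2025 / 8 * a))) = 1 / (Real.sqrt (max 2 (16 / a)) * Real.sqrt (27 + 2025 / 8 * a)) by
    field_simp]
  rw [div_le_one (by positivity)]
  exact h1

end Summit.QuantumFields.YangMills.Theorems.Prop7LODBudgetLetters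

end
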